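import Mathlib

/-!
# `GappedShellCensus.FiveFoldRationingR`, stub W: non-backtracking five-fold walks

For a configuration `Y ⊆ ℝ³` at scale `a > 0` write `r = a (1 + 1/50)` and, for a site `y`, let
`FB y` be the set of FIVE-BOND partners of `y`: the sites `v ∈ Y`, `v ≠ y`, `dist y v ≤ r`, such
that `y` and `v` have at least five common bond partners.  The relation `v ∈ FB y` is symmetric
(the set of common partners of `(y, v)` and of `(v, y)` is the same set).  If every site has either
no five-bond or exactly two (NoBranching), then from every five-bond `(y₀, v₀)` there is an infinite
walk `f : ℕ → Y`, `f 0 = y₀`, `f 1 = v₀`, along five-bonds which never backtracks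
(`f (n + 2) ≠ f n`): arriving at `cur` from `prev`, the site `cur` has the five-bond partner `prev`,
hence exactly two five-bond partners, and the walk continues to the other one.  This is an abstract
graph statement (`ffrCh_walk`); no geometry is used.
-/

noncomputable section

namespace Summit.AtomisticToContinuum.Crystallization.Theorems

/-- One step of the walk.  For a "partner" map `FB` on a set `Y` which is symmetric, lands in `Y`,
and takes at every site of `Y` either no value or exactly two, every partner `cur` of a site
`prev ∈ Y` has a partner different from `prev`. -/
theorem ffrCh_next {E : Type*} (Y : Set E) (FB : E → Set E)
    (hsymm : ∀ y ∈ Y, ∀ v, v ∈ FB y → y ∈ FB v) (hsub : ∀ y v, v ∈ FB y → v ∈ Y)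
    (hN : ∀ y ∈ Y, FB y = ∅ ∨ (FB y).ncard = 2) {prev cur : E} (hprev : prev ∈ Y)
    (hcur : cur ∈ FB prev) : ∃ nxt ∈ FB cur, nxt ≠ prev := by
  have hcurY : cur ∈ Y := hsub prev cur hcur
  have hback : prev ∈ FB cur := hsymm prev hprev cur hcur
  rcases hN cur hcurY with h0 | h2
  · rw [h0] at hback
    exact absurd hback (Set.notMem_empty _)
  · obtain ⟨p, q, hpq, hFB⟩ := Set.ncard_eq_two.1 h2
    by_cases hp : p = prev
    · refine ⟨q, ?_, ?_⟩
      · rw [hFB]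
        exact Set.mem_insert_of_mem _ (Set.mem_singleton _)
      · rintro rfl
        exact hpq hp
    · refine ⟨p, ?_, hp⟩
      rw [hFB]
      exact Set.mem_insert _ _

/-- The abstract non-backtracking walk.  For a "partner" map `FB` on a set `Y` which is symmetric,
lands in `Y`, and takes at every site of `Y` either no value or exactly two, from every pair
`(y₀, v₀)` with `y₀ ∈ Y`, `v₀ ∈ FB y₀` there is a sequence `f : ℕ → E` with `f 0 = y₀`, `f 1 = v₀`,
`f (n + 1) ∈ FB (f n)` and `f (n + 2) ≠ f n` for all `n`.  The walk is built by iterating a step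
function on states `(current, previous)`. -/
theorem ffrCh_walk {E : Type*} (Y : Set E) (FB : E → Set E)
    (hsymm : ∀ y ∈ Y, ∀ v, v ∈ FB y → y ∈ FB v) (hsub : ∀ y v, v ∈ FB y → v ∈ Y)
    (hN : ∀ y ∈ Y, FB y = ∅ ∨ (FB y).ncard = 2) (y₀ : E) (hy₀ : y₀ ∈ Y) (v₀ : E)
    (hv₀ : v₀ ∈ FB y₀) :
    ∃ f : ℕ → E, f 0 = y₀ ∧ f 1 = v₀ ∧ (∀ n, f n ∈ Y) ∧ (∀ n, f (n + 1) ∈ FB (f n)) ∧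
      (∀ n, f (n + 2) ≠ f n) := by
  -- one step of the walk on states `(current, previous)`
  have hex : ∀ p : E × E, ∃ q : E × E, (p.2 ∈ Y ∧ p.1 ∈ FB p.2) →
      ((q.2 ∈ Y ∧ q.1 ∈ FB q.2) ∧ q.2 = p.1 ∧ q.1 ≠ p.2) := by
    rintro ⟨cur, prev⟩
    by_cases h : prev ∈ Y ∧ cur ∈ FB prev
    · obtain ⟨nxt, hnxt, hne⟩ := ffrCh_next Y FB hsymm hsub hN h.1 h.2
      exact ⟨(nxt, cur), fun _ => ⟨⟨hsub prev cur h.2, hnxt⟩, rfl, hne⟩⟩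
    · exact ⟨(cur, prev), fun h' => absurd h' h⟩
  choose step hstep using hex
  -- the invariant along the iterates of `step` started at `(v₀, y₀)`
  have hI : ∀ n, (step^[n] (v₀, y₀)).2 ∈ Y ∧ (step^[n] (v₀, y₀)).1 ∈ FB (step^[n] (v₀, y₀)).2 := by
    intro n
    induction n with
    | zero => exact ⟨hy₀, hv₀⟩
    | succ n ih =>
      rw [Function.iterate_succ_apply']
      exact (hstep _ ih).1
  refine ⟨fun n => (step^[n] (v₀, y₀)).2, rfl, ?_, fun n => (hI n).1, ?_, ?_⟩
  · show (step^[1] (v₀, y₀)).2 = v₀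
    rw [Function.iterate_one]
    exact (hstep _ (hI 0)).2.1
  · intro n
    show (step^[n + 1] (v₀, y₀)).2 ∈ FB (step^[n] (v₀, y₀)).2
    rw [Function.iterate_succ_apply', (hstep _ (hI n)).2.1]
    exact (hI n).2
  · intro n
    show (step^[n + 1 + 1] (v₀, y₀)).2 ≠ (step^[n] (v₀, y₀)).2
    rw [Function.iterate_succ_apply', (hstep _ (hI (n + 1))).2.1, Function.iterate_succ_apply']
    exact (hstep _ (hI n)).2.2

/-- **Stub W (FIVE-FOLD WALKS).** If at every site of `Y` the set of five-bond partners (bond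
partners `v`, `dist y v ≤ a (1 + 1/50)`, with at least five common bond partners) is empty or has
exactly two elements, then from every five-bond `(y₀, v₀)` there is an infinite non-backtracking walk
along five-bonds starting `y₀, v₀, …`.  The five-bond relation is symmetric, so this is the abstract
walk `ffrCh_walk`. -/
theorem stub_ffrChain :
    ∀ (Y : Set (EuclideanSpace ℝ (Fin 3))) (a : ℝ), 0 < a →
      (∀ y ∈ Y, {v ∈ Y | v ≠ y ∧ dist y v ≤ a * (1 + 1 / 50) ∧
          5 ≤ {w ∈ Y | w ≠ y ∧ w ≠ v ∧ dist y w ≤ a * (1 + 1 / 50) ∧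
            dist v w ≤ a * (1 + 1 / 50)}.ncard} = ∅ ∨
        ({v ∈ Y | v ≠ y ∧ dist y v ≤ a * (1 + 1 / 50) ∧
          5 ≤ {w ∈ Y | w ≠ y ∧ w ≠ v ∧ dist y w ≤ a * (1 + 1 / 50) ∧
            dist v w ≤ a * (1 + 1 / 50)}.ncard}).ncard = 2) →
      ∀ y₀ ∈ Y, ∀ v₀ ∈ {v ∈ Y | v ≠ y₀ ∧ dist y₀ v ≤ a * (1 + 1 / 50) ∧
          5 ≤ {w ∈ Y | w ≠ y₀ ∧ w ≠ v ∧ dist y₀ w ≤ a * (1 + 1 / 50) ∧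
            dist v w ≤ a * (1 + 1 / 50)}.ncard},
        ∃ f : ℕ → EuclideanSpace ℝ (Fin 3), f 0 = y₀ ∧ f 1 = v₀ ∧ (∀ n, f n ∈ Y) ∧
          (∀ n, f (n + 1) ∈ {v ∈ Y | v ≠ (f n) ∧ dist (f n) v ≤ a * (1 + 1 / 50) ∧
          5 ≤ {w ∈ Y | w ≠ (f n) ∧ w ≠ v ∧ dist (f n) w ≤ a * (1 + 1 / 50) ∧
            dist v w ≤ a * (1 + 1 / 50)}.ncard}) ∧
          (∀ n, f (n + 2) ≠ f n) := by
  intro Y a _ hN y₀ hy₀ v₀ hv₀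
  refine ffrCh_walk Y (fun y => {v ∈ Y | v ≠ y ∧ dist y v ≤ a * (1 + 1 / 50) ∧
      5 ≤ {w ∈ Y | w ≠ y ∧ w ≠ v ∧ dist y w ≤ a * (1 + 1 / 50) ∧
        dist v w ≤ a * (1 + 1 / 50)}.ncard}) ?_ ?_ hN y₀ hy₀ v₀ hv₀
  · -- the five-bond relation is symmetric
    intro y hy v hv
    obtain ⟨_, hvy, hd, h5⟩ := hv
    refine ⟨hy, fun h => hvy h.symm, ?_, ?_⟩
    · rw [dist_comm]
      exact hd
    · have hset : {w ∈ Y | w ≠ v ∧ w ≠ y ∧ dist v w ≤ a * (1 + 1 / 50) ∧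
          dist y w ≤ a * (1 + 1 / 50)} = {w ∈ Y | w ≠ y ∧ w ≠ v ∧ dist y w ≤ a * (1 + 1 / 50) ∧
          dist v w ≤ a * (1 + 1 / 50)} := by
        ext w
        simp only [Set.mem_setOf_eq]
        tauto
      show 5 ≤ {w ∈ Y | w ≠ v ∧ w ≠ y ∧ dist v w ≤ a * (1 + 1 / 50) ∧
          dist y w ≤ a * (1 + 1 / 50)}.ncard
      rw [hset]
      exact h5
  · -- five-bond partners are sites
    intro y v hv
    exact hv.1

end Summit.AtomisticToContinuum.Crystallization.Theorems

end
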